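import Literature.MathematicalPhysics.QuantumFieldTheory.Balaban1983to89.T4TowerRateDischarge
import Literature.MathematicalPhysics.QuantumFieldTheory.Balaban1983to89.T4BetaReadOutLipschitz
import Literature.MathematicalPhysics.QuantumFieldTheory.Balaban1983to89.T4CurrencyMatching
import Summits.QuantumFields.BalabanUV.T4Continuum.Support.NE9LastCouplingBridge
import Summits.QuantumFields.BalabanUV.T4Continuum.Support.OutputRateTowerSocket

/-!
# NE4ReadOutSocketTower — binder row NE4 (spine node U2) with row NE5's η-RATE INPUTS READ FROM THE SPINE ROWS BY NAME:
# node U2's NE4 triple, its `InjectedRate` and the spine's `K`-uniform `URateUpTo K` from row NE9's END theorem, row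
# NE5's residual with W1 := row NE2's one-step averaged LAW on a family of towers ∧ row NE3's minimiser `LocalRate`
# (`OutputRateTowerSocket.operatorRate_of_towerLaw_split`) AND W4 PRODUCED from that same W1
# (`OutputRateInsertion.insertionRate_of_operatorRate`), and the read-out (R) (cell `pub-balaban`, T⁴-continuum fan-out,
# `HOME/BINDER-OWNERS.md` row NE4, owner lineage t4-ne4-p1, generation 30; third sibling of `NE4ReadOutSocket` /
# `NE4ReadOutSocketInsertion` — those leaves stay byte-unchanged)

HONEST FRAMING (T4-DAG PAGE 1).  The cell's T⁴ target is rung (B)+1: existence AND uniqueness of the ε → 0 limit of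
gauge-invariant observables on a FIXED finite torus T⁴ — NOT infinite volume, NOT a mass gap, NOT the Clay problem.  The
spine estimate NE4 («η-rate of the full β_k», shape `T4CouplingMatching.ScaleShiftRate`) is NOT PRINTED in
[Balaban1987RG1]–[Balaban1989LargeFieldII] (print bounds the SIZE of the new term of one renormalization step, never a
modulus of continuity of the one-step map in the older terms; lineage record `t4/T4-EST-NE4-P1.md` §1 (S5)) and is NOT
PROVED here: node U2 is DEPENDENT — (R)∘{NE5, NE9} — and NE9, NE2 (at U ≠ 1: open row G-an2-4), NE3 and row NE5's
remaining walls are the cell's own estimates, NOT PRINTED, NOT PROVED (spine estimates proved: 0/9, unchanged by this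
module).  Nothing printed is asserted; no «…» quotation is introduced (0 cite tags).  `FlowStep.BetaPertH`, (B), (B^μ) do
not occur and are NOT hidden: they live in the window `W` / the runs of whoever instantiates.  HONEST DEPENDENCY (cell,
verbatim): continuum YM on T⁴ ⇐ BetaPertH ∧ nine spine estimates (0/9 proved); BetaPertH ⇐ (D1) ∧ (D4) ∧ CAP+tail; G-an2-4
gates asym, D1 and NE2/3/4.

WHAT THIS MODULE IS.  Row NE5 (t4-ne5-p1) wrote both of its DAG junctions BY NAME: W1 = «NE2 ∧ NE3» as
`OutputRateTowerSocket.operatorRate_of_towerLaw_split` (p203601: `OperatorRate W (cR·Cop/r₀ + Λb·Cm) θ₁` from row NE2's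
`CovariantAveragingTower.OneStepAveragedLaw` over a FAMILY of towers — `TowerLaw A Xt r Cop θ₂`, `TowerContracting A r` —
read on the pair (run A, `opMid`) by `ReadsTowerMid` (constant `cR`), + the background-Lipschitz leg `‖opMid − opB‖ ≤
Λb·dist·rOp`, + row NE3's `T4EtaRateMin.LocalRate R₃ Cm θ₁` dominating the minimiser distance, + the margin floor `r₀`),
and W4 PRODUCED from that SAME W1 as `OutputRateInsertion.insertionRate_of_operatorRate` (p202795; same-data species
`InsOpModel.ofStep M Ins`: `ReadsIns`, `InsOpEnvelope κ E₀ Gi`, `InsBoundA κ E₀ Gi`, insertion reach `δ₁θ₁^{k₁} ≤ ρ₁ < 1`).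
Both fed into the Data leaf's closure `StepModel.ne5_at_of_stepModel_lip_nat` give `NE5 EA EB W κ θ₅ C₅` with NO η-rate
binder of row NE5 left; this leaf plugs that into node U2 exactly as `NE4ReadOutSocket` plugs
`OutputRateResidual.ne5_at_of_entrywise_lip_nat`, with `δ₁ := cR·Cop/r₀ + Λb·Cm`, `δ₅ := Gi·δ₁/(1 − ρ₁) + 2Gi/θ₁^{k₁}`,
`C₅ := (Λ₅(δ₁ + δ₅) + B₅)(θ₅ − ω₅)/(θ₅ − (ω₅ + Λ₅c₅))` DISPLAYED (`hδ₁`, `hδ₅`, `hC₅`): §1 `ne4_of_endNE9_towerSplitIns` —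
THE ROW's TRIPLE `ScaleShiftRate (cr·C₅·θ₅) θ₅ γ β ∧ HistLipschitz (cr·Λ(·+1)) γ β ∧ FadingMemory (cr·(ℓ/ν)·ν) ν (cr·Λ(·+1))`
from row NE9's END binders (verbatim), the above per datum `b′ ∈ ]0, γ]` of the READ-OUT FAMILY through datum-indexed
`Mf b′` / `Insf b′` / `towf b′` / `opMidf b′` / `distf b′` with datum-FREE scalars (ONE tower family, ONE law with
`θ₂ ≤ θ₁`, ONE minimiser carrier `R₃`, ONE `Gi`/`ρ₁`/`k₁`), and (R); §2 `injectedRate_of_endNE9_towerSplitIns` — node U2's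
OUTPUT `InjectedRate (2(cr·C₅·θ₅)/(1 − ρ)) 0 ρ (disc of the runs)` by the GAP-ONLY closure (NO asymptotic-freedom input);
§3 `uRateUpTo_of_endNE9_towerSplitIns` — the spine's `K`-UNIFORM `URateUpTo K` (`uRateUpTo_of_nodes`, `hinj :=` §2), the
tower pair through ONE `M` read the same way (`Ins`, `tow`, `opMid`, `dist`); the spine's node-U5 readings carrier `R` is
kept SEPARATE from `R₃`.

WHAT REMAINS DISPLAYED AT NODE U2 after this leaf — its η-RATE inputs are exactly: row NE9's END binders (`TwoPointKP`,
`hCup`, `hTcup`, explicit-part modulus, `DecayExtract`/`PinBudget`, `hocc`; PROOF-INTERIOR of (B) per row NE9), row NE2's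
LAW `TowerLaw` (U ≠ 1 = open row G-an2-4; a theorem at U = 1 in row NE2's leaves), row NE3's `LocalRate R₃ Cm θ₁` — all
NOT PRINTED; plus row NE5's non-rate walls W2 / W2-ins (`InsOpEnvelope`: a printed ONE-run analyticity re-read along a
substituted operator deformation — NOT a cited fact under the ABSOLUTE RULE) / W3 / MI-R, the READINGS `ReadsTowerMid` /
`hLip` / `hdom` / `ReadsIns` (data of an instantiation); printed STRUCTURE `hA`/`hB`, `ScaleZeroFree`…`Factorises`, `hrepr`,
`TowerContracting`; printed TYPE `cr`, `cR`, `Λb`, `r₀`, `Gi`; node U1/H3 runs/box/pin; (B)/(B^μ)/BetaPertH inside `W`;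
scalars: memory gap `ν < ρ`, window, S `ω₅ + Λ₅c₅ < θ₅`, reaches `ρ₀`/`ρ₁` (k₁-eventual), `0 < θ₁`, `θ₂ ≤ θ₁ ≤ θ₅ ≤ ρ`.

WHAT IS PROVED: bookkeeping only (`subst` of five displayed abbreviations, two sign computations, compositions of the
imported theorems BY NAME).  0 sorry; axioms ⊆ {propext, Classical.choice, Quot.sound}; imports the LANDED modules
`T4TowerRateDischarge`, `T4BetaReadOutLipschitz`, `T4CurrencyMatching`, `Support/NE9LastCouplingBridge` (p201771) and
`Support/OutputRateTowerSocket` (p203601, which imports `Support/OutputRateInsertion` p202795) and modifies nothing of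
them.  NOT COVERED: any instance of a binder for Bałaban's objects; NE2 (G-an2-4), NE3, NE5's W2/W3/MI-R, NE9, BetaPertH,
(B), (B^μ).  Rung (B)+1 finite T⁴; NOT summit progress.
-/

namespace Summit.QuantumFields.BalabanUV.T4Continuum.NE4ReadOutSocketTower

open scoped Matrix Matrix.Norms.L2Operator
open Literature.MathematicalPhysics.QuantumFieldTheory.Balaban1983to89
open FlowStep (HBeta RGEqH Box)
open T4OutputRate (Carriers Functional NE5 NE9 LipBackground DecayBound)
open T4CouplingMatching (disc ScaleShiftRate HistLipschitz)
open T4CauchySum (InjectedRate)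
open T4EtaRateMin (Readings LocalRate)
open T4RateLiaison (GaugeDominated)
open T4TowerRateComposition (URateUpTo PolyLipGrowth)
open T4TowerRateDischarge (uRateUpTo_of_nodes)
open T4BetaReadOut (Slice ReadOut RepresentsA RepresentsB)
open T4BetaReadOutLipschitz (ReadBoundedOn ReadCovariantOn ne4_of_u3_on)
open T4FlagMemory (extd)
open T4HistoryLipschitzRecursion (prodModuli ScaleZeroFree AdmissibleTerms AdmRestrict ChannelAdditive ChannelStepSum
  ChannelSizeAtStepNN)
open T4HistoryLipschitzOuter (Factorises)
open T4HistoryLipschitzActivity (ClusterGeom)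
open T4HistoryLipschitzSegment (TwoPointKP)
open T4InputCauchyRateData (StepModel)
open NE9LastCouplingBridge (ne9_and_fadingMemory_of_couplingTwoPoint)
open OutputRateInsertion (InsOpModel insertionRate_of_operatorRate)
open OutputRateTowerSocket (TowerContracting TowerLaw ReadsTowerMid operatorRate_of_towerLaw_split)

variable {C : Carriers} {ι X : Type}

/-! ## §0 Signs of the produced constants -/

/-- W1's margin-unit constant `δ₁ = cR·Cop/r₀ + Λb·Cm` and the produced W4 constant `δ₅ = Gi·δ₁/(1 − ρ₁) + 2Gi/θ₁^{k₁}` are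
nonnegative, hence so is `δ₁ + δ₅`. [folklore] -/
theorem splitInsConst_nonneg {cR Cop r₀ Λb Cm Gi ρ₁ θ₁ : ℝ} {k₁ : ℕ} (hcR : 0 ≤ cR) (hCop : 0 ≤ Cop) (hr₀ : 0 < r₀)
    (hΛb : 0 ≤ Λb) (hCm : 0 ≤ Cm) (hGi : 0 ≤ Gi) (hρ₁ : ρ₁ < 1) (hθ₁ : 0 < θ₁) :
    0 ≤ cR * Cop / r₀ + Λb * Cm ∧
      0 ≤ cR * Cop / r₀ + Λb * Cm + (Gi * (cR * Cop / r₀ + Λb * Cm) / (1 - ρ₁) + 2 * Gi / θ₁ ^ k₁) := by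
  have h1 : 0 ≤ cR * Cop / r₀ + Λb * Cm := add_nonneg (div_nonneg (mul_nonneg hcR hCop) hr₀.le) (mul_nonneg hΛb hCm)
  exact ⟨h1, add_nonneg h1 (add_nonneg (div_nonneg (mul_nonneg hGi h1) (by linarith))
    (div_nonneg (by positivity) (pow_pos hθ₁ k₁).le))⟩

/-- `C₅ = (Λ₅·D + B₅)(θ₅ − ω₅)/(θ₅ − (ω₅ + Λ₅c₅)) ≥ 0` for `D ≥ 0` under row NE5's sign binders and S. [folklore] -/
theorem faceConst_nonneg {Λ₅ D θ₅ c₅ ω₅ B₅ : ℝ} (hΛ₅ : 0 ≤ Λ₅) (hD : 0 ≤ D) (hc₅ : 0 ≤ c₅) (hB₅ : 0 ≤ B₅)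
    (hsmall5 : ω₅ + Λ₅ * c₅ < θ₅) : 0 ≤ (Λ₅ * D + B₅) * (θ₅ - ω₅) / (θ₅ - (ω₅ + Λ₅ * c₅)) := by
  have h2 : 0 ≤ Λ₅ * c₅ := mul_nonneg hΛ₅ hc₅
  exact div_nonneg (mul_nonneg (add_nonneg (mul_nonneg hΛ₅ hD) hB₅) (by linarith)) (by linarith)
/-! ## §1 The row's triple at node U2, row NE5's W1 read from rows NE2 ∧ NE3 -/

/-- **ROW NE4 — NODE U2's TRIPLE FROM ROW NE9's END THEOREM, ROW NE5's RESIDUAL WITH W1 := NE2's LAW ∧ NE3's `LocalRate`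
AND W4 PRODUCED FROM IT, AND THE READ-OUT (R), BY NAME.**  Binders: (NE9-END) verbatim as in `NE4ReadOutSocket` §1, `hℓ`/`hν`
displayed; (NE5) ONE tower family `hrt`/`hAt`/`hlaw`, ONE minimiser carrier `hR₃`/`hCm`, per datum `b′ ∈ ]0, γ]` the readings
`hreadf`/`hLipf`/`hdomf`, MI-R `hrAf`/`hrBf`/`hbasef`, W2 `hlipf`, decay `hdA`/`hdBf`, floor `hflf`, insertion species
`hreadIf`/`hienvf`/`hbdAf`, W3 `hdampf`; datum-FREE `hδ₁ hGi hρ₁ hreach hδ₅ hΛ₅ hθ₁ hθ₁₅ hθ₅1 hc₅ hω₅ hnear hB₅ hfirst hsmall5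
hC₅`; (R) `hW hA hB h𝒜A h𝒜B hr hcov hcr`.  Conclusion = `T4BetaReadOutLipschitz.ne4_of_u3_on` on these. [folklore] -/
theorem ne4_of_endNE9_towerSplitIns (G : ClusterGeom C) {Pot : Type*} [NormedAddCommGroup Pot] [NormedSpace ℂ Pot]
    {Op Hist : Type*} [NormedAddCommGroup Op] [NormedSpace ℂ Op] [NormedAddCommGroup Hist] [NormedSpace ℂ Hist]
    [CompleteSpace Hist] {J : Type*} {ιt : J → ℕ → Type*} [∀ j k, Fintype (ιt j k)] [∀ j k, DecidableEq (ιt j k)]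
    (Mf : ℝ → StepModel C Op Hist) (Insf : ℝ → ℕ → Op → (C.Dom → ℝ) → Hist) {ιc : Type} {EA : Functional C C.BgA} {W : Set (ℕ → ℝ)}
    {Adm : Set (C.BgA → C.Dom → ℝ)} {T : ℕ → (ℕ → ℝ) → (C.BgA → C.Dom → ℝ) → ιc → ℝ}
    {Ψ : ℕ → ℝ → (ιc → ℝ) → C.BgA → C.Dom → ℝ} {act : ℕ → ℝ → C.BgA → Pot → G.P → ℂ} {𝒜 : ℕ → Set Pot}
    {n : ℕ → ℝ → C.BgA → G.P → ℝ} {lip clip : ℕ → ℝ} {aP dP : G.P → ℝ} {δ : C.Dom → ℝ}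
    {κ B lipbar clipbar pexbar qTbar τbar ω ℓ ν : ℝ} {wt : ℕ → ιc → ℝ} {τ : ℕ → ℕ → ℝ} {pex qT : ℕ → ℝ}
    (ρT : ℕ → (ιc → ℝ) → Pot) (expl : ℕ → ℝ → C.BgA → C.Dom → ℝ)
    -- ===== row NE9's END theorem: the binders of `ne9_and_fadingMemory_of_couplingTwoPoint`, verbatim =====
    (h0 : ScaleZeroFree EA W) (hAdm : AdmissibleTerms EA W Adm) (hres : AdmRestrict Adm) (hadd : ChannelAdditive Adm T)
    (hsum : ChannelStepSum Adm T) (hstep : ChannelSizeAtStepNN Adm T κ wt τ) (hfac : Factorises EA W T Ψ)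
    (hclip0 : ∀ k, 0 ≤ clip k)
    (hCup : ∀ g ∈ W, ∀ g' ∈ W, ∀ (k : ℕ) (U : C.BgA) (X : C.Dom), C.scale X = k + 1 → ∀ Q ∈ 𝒜 k, ∀ γ ∈ G.vol X,
      ‖act k (g k) U Q γ‖ ≤ n k (g' k) U γ ∧
        ‖act k (g k) U Q γ - act k (g' k) U Q γ‖ ≤ clip k * |g k - g' k| * n k (g' k) U γ)
    (hqT0 : ∀ k, 0 ≤ qT k)
    (hTcup : ∀ g ∈ W, ∀ g' ∈ W, ∀ (k : ℕ) (y : ιc), |T k g (EA g) y - T k g' (EA g) y| ≤ wt k y * (qT k * |g k - g' k|))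
    (hrepr : ∀ (k : ℕ) (s : ℝ) (P : ιc → ℝ) (U : C.BgA) (X : C.Dom),
      Ψ k s P U X = (G.newTerm act k s U X (ρT k P)).re + expl k s U X)
    (hexpl : ∀ g ∈ W, ∀ g' ∈ W, ∀ (k : ℕ) (U : C.BgA) (X : C.Dom), C.scale X = k + 1 →
      |expl k (g k) U X - expl k (g' k) U X| ≤ Real.exp (-(κ * C.d X)) * (pex k * |g k - g' k|))
    (hclipb : ∀ k, clip k ≤ clipbar) (hpexb : ∀ k, pex k ≤ pexbar) (hpexbar : 0 ≤ pexbar) (hqTb : ∀ k, qT k ≤ qTbar)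
    (hKP : TwoPointKP G W act 𝒜 n lip aP dP) (hdec : G.DecayExtract δ dP) (hpinB : G.PinBudget aP δ (fun _ => B) κ)
    (hρT : ∀ (k : ℕ) (P P' : ιc → ℝ) (M : ℝ), (∀ y, |P y - P' y| ≤ wt k y * M) → ‖ρT k P - ρT k P'‖ ≤ M)
    (hocc : ∀ g ∈ W, ∀ g' ∈ W, ∀ k : ℕ, ρT k (T k g' (EA g)) ∈ 𝒜 k) (hB0 : 0 ≤ B)
    (hlipb : ∀ k, lip k ≤ lipbar) (hτbar : 0 ≤ τbar) (hω : 0 ≤ ω) (hpos : 0 < ω + 4 * lipbar * B * τbar)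
    (hτ : ∀ k j, j ≤ k → 0 ≤ τ k j ∧ τ k j ≤ τbar * ω ^ (k - j))
    (hℓ : 4 * clipbar * B + pexbar + 4 * lipbar * B * qTbar = ℓ) (hν : ω + 4 * lipbar * B * τbar = ν)
    -- ===== row NE5's END, tower-split face (W1 := NE2's law ∧ NE3's LocalRate), read-out family, datum-free scalars =====
    {A : (j : J) → (k : ℕ) → Matrix (ιt j k) (ιt j (k + 1)) ℂ} {Xt : (j : J) → (k : ℕ) → Matrix (ιt j k) (ιt j k) ℂ}
    {r Cop θ₂ cR r₀ Λb Cm : ℝ} (towf : ℝ → ℕ → (ℕ → ℝ) → C.BgB → J) (opMidf : ℝ → (ℕ → ℝ) → C.BgB → ℕ → Op)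
    (distf : ℝ → ℕ → (ℕ → ℝ) → C.BgB → ℝ) {ιR XR : Type*} (R₃ : Readings ιR XR)
    {EBfam : ℝ → Functional C C.BgB} {γ Λ₅ EA₀ E₀ Gi ρ₁ δ₁ δ₅ θ₁ θ₅ c₅ ω₅ ρ₀ B₅ C₅ : ℝ} {k₅ k₁ : ℕ}
    (hrt : 0 < r) (hAt : TowerContracting A r) (hlaw : TowerLaw A Xt r Cop θ₂)
    (hreadf : ∀ b', 0 < b' → b' ≤ γ → ReadsTowerMid (Mf b') A Xt r W cR (towf b') (opMidf b'))
    (hcR : 0 ≤ cR) (hCop : 0 ≤ Cop) (hθ₂ : 0 ≤ θ₂) (hθ₂₁ : θ₂ ≤ θ₁)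
    (hflf : ∀ b', 0 < b' → b' ≤ γ → ∀ k, r₀ ≤ (Mf b').rOp k) (hr₀ : 0 < r₀)
    (hLipf : ∀ b', 0 < b' → b' ≤ γ → ∀ k, ∀ g ∈ W, ∀ (U : C.BgB),
      ‖opMidf b' g U k - (Mf b').opB g U k‖ ≤ Λb * distf b' k g U * (Mf b').rOp k) (hΛb : 0 ≤ Λb)
    (hR₃ : LocalRate R₃ Cm θ₁) (hCm : 0 ≤ Cm)
    (hdomf : ∀ b', 0 < b' → b' ≤ γ → ∀ k, ∀ g ∈ W, ∀ (U : C.BgB),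
      ∃ V ∈ R₃.dom, ∃ x : XR, distf b' k g U ≤ |R₃.loc (k + 1) V x - R₃.loc k V x|)
    (hdA : DecayBound EA W EA₀ κ)
    (hrAf : ∀ b', 0 < b' → b' ≤ γ → (Mf b').RepresentsA EA W)
    (hrBf : ∀ b', 0 < b' → b' ≤ γ → (Mf b').RepresentsB (EBfam b') W)
    (hbasef : ∀ b', 0 < b' → b' ≤ γ → (Mf b').InBase (EBfam b') W)
    (hlipf : ∀ b', 0 < b' → b' ≤ γ → (Mf b').DataLipschitz W κ Λ₅ ρ₀)
    (hdBf : ∀ b', 0 < b' → b' ≤ γ → DecayBound (EBfam b') W E₀ κ)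
    (hreadIf : ∀ b', 0 < b' → b' ≤ γ → (InsOpModel.ofStep (Mf b') (Insf b')).ReadsIns W)
    (hienvf : ∀ b', 0 < b' → b' ≤ γ → (InsOpModel.ofStep (Mf b') (Insf b')).InsOpEnvelope W κ E₀ Gi)
    (hbdAf : ∀ b', 0 < b' → b' ≤ γ → (InsOpModel.ofStep (Mf b') (Insf b')).InsBoundA W κ E₀ Gi)
    (hdampf : ∀ b', 0 < b' → b' ≤ γ → (Mf b').InsertionDampedNat W κ c₅ ω₅)
    (hδ₁ : cR * Cop / r₀ + Λb * Cm = δ₁) (hGi : 0 ≤ Gi) (hρ₁ : ρ₁ < 1) (hreach : δ₁ * θ₁ ^ k₁ ≤ ρ₁)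
    (hδ₅ : Gi * δ₁ / (1 - ρ₁) + 2 * Gi / θ₁ ^ k₁ = δ₅)
    (hΛ₅ : 0 ≤ Λ₅) (hθ₁ : 0 < θ₁) (hθ₁₅ : θ₁ ≤ θ₅) (hθ₅1 : θ₅ ≤ 1) (hc₅ : 0 ≤ c₅) (hω₅ : 0 < ω₅)
    (hnear : (δ₁ + δ₅) * θ₁ ^ k₅ + c₅ * (EA₀ + E₀) / (1 - ω₅) ≤ ρ₀) (hB₅ : 0 ≤ B₅)
    (hfirst : ∀ k < k₅, EA₀ + E₀ ≤ B₅ * θ₁ ^ k) (hsmall5 : ω₅ + Λ₅ * c₅ < θ₅)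
    (hC₅ : (Λ₅ * (δ₁ + δ₅) + B₅) * (θ₅ - ω₅) / (θ₅ - (ω₅ + Λ₅ * c₅)) = C₅)
    -- ===== node U2's read-out (R) =====
    {𝒜A : Set (Slice C C.BgA)} {𝒜B : Set (Slice C C.BgB)} {rA : ReadOut C C.BgA} {rB : ReadOut C C.BgB} {β : HBeta}
    {cr : ℝ} (hW : ∀ k (v : Fin (k + 1) → ℝ), v ∈ Box γ k → extd v ∈ W)
    (hA : RepresentsA EA rA γ β) (hB : RepresentsB EBfam rB γ β)
    (h𝒜A : ∀ g' ∈ W, EA g' ∈ 𝒜A) (h𝒜B : ∀ b', 0 < b' → b' ≤ γ → ∀ g' ∈ W, EBfam b' g' ∈ 𝒜B)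
    (hr : ReadBoundedOn 𝒜A rA κ cr) (hcov : ReadCovariantOn 𝒜A 𝒜B rA rB κ cr) (hcr : 0 ≤ cr) :
    ScaleShiftRate (cr * C₅ * θ₅) θ₅ γ β ∧
      HistLipschitz (fun k i => cr * prodModuli ℓ (fun _ => ν) (k + 1) i) γ β ∧
        T4CouplingMatching.FadingMemory (cr * (ℓ / ν) * ν) ν (fun k i => cr * prodModuli ℓ (fun _ => ν) (k + 1) i) := by
  subst hℓ hν hδ₁ hδ₅ hC₅
  have hK := ne9_and_fadingMemory_of_couplingTwoPoint G ρT expl h0 hAdm hres hadd hsum hstep hfac hclip0 hCup hqT0 hTcup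
    hrepr hexpl hclipb hpexb hpexbar hqTb hKP hdec hpinB hρT hocc hB0 hlipb hτbar hω hpos hτ
  obtain ⟨hd₁, hd⟩ := splitInsConst_nonneg (k₁ := k₁) hcR hCop hr₀ hΛb hCm hGi hρ₁ hθ₁
  have hθ₁1 : θ₁ ≤ 1 := hθ₁₅.trans hθ₅1
  exact ne4_of_u3_on hW
    (fun b' hb hbγ =>
      have hop := operatorRate_of_towerLaw_split (Mf b') (opMidf b') (distf b') R₃ hrt hAt hlaw (hreadf b' hb hbγ) hcR
        hCop hθ₂ hθ₂₁ (hflf b' hb hbγ) hr₀ (hLipf b' hb hbγ) hΛb hR₃ (hdomf b' hb hbγ)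
      (Mf b').ne5_at_of_stepModel_lip_nat (hrAf b' hb hbγ) (hrBf b' hb hbγ) (hbasef b' hb hbγ) (hlipf b' hb hbγ) hdA
        (hdBf b' hb hbγ) hop
        (insertionRate_of_operatorRate (Mf b') (Insf b') (hreadIf b' hb hbγ) (hienvf b' hb hbγ) (hbdAf b' hb hbγ) hop
          hd₁ hθ₁ hθ₁1 hρ₁ hreach)
        (hdampf b' hb hbγ) hΛ₅ hd hθ₁.le hθ₁₅ hθ₅1 hc₅ hω₅ hnear hB₅ hfirst hsmall5)
    hK.1 hK.2 hA hB h𝒜A h𝒜B hr hcov hcr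
/-! ## §2 Node U2's output in the spine's currency (gap route, no asymptotic-freedom input) -/

/-- **ROW NE4 — NODE U2's OUTPUT `InjectedRate`, SAME INPUTS + THE RUNS, BY NAME.**  §1's binders plus node U1/H3's runs of
(0.20) with history, box, pin, `θ₅ ≤ ρ`, memory gap `ν < ρ`, `0 < ρ < 1`, `0 ≤ γ`, window `hsmall`; conclusion =
`T4CurrencyMatching.injectedRate_of_runs_gap` on §1's triple.  NO `EventualLowerH`, NO `0 < b`. [folklore] -/
theorem injectedRate_of_endNE9_towerSplitIns (G : ClusterGeom C) {Pot : Type*} [NormedAddCommGroup Pot]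
    [NormedSpace ℂ Pot] {Op Hist : Type*} [NormedAddCommGroup Op] [NormedSpace ℂ Op] [NormedAddCommGroup Hist]
    [NormedSpace ℂ Hist] [CompleteSpace Hist] {J : Type*} {ιt : J → ℕ → Type*} [∀ j k, Fintype (ιt j k)] [∀ j k, DecidableEq (ιt j k)]
    (Mf : ℝ → StepModel C Op Hist) (Insf : ℝ → ℕ → Op → (C.Dom → ℝ) → Hist) {ιc : Type} {EA : Functional C C.BgA} {W : Set (ℕ → ℝ)}
    {Adm : Set (C.BgA → C.Dom → ℝ)} {T : ℕ → (ℕ → ℝ) → (C.BgA → C.Dom → ℝ) → ιc → ℝ}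
    {Ψ : ℕ → ℝ → (ιc → ℝ) → C.BgA → C.Dom → ℝ} {act : ℕ → ℝ → C.BgA → Pot → G.P → ℂ} {𝒜 : ℕ → Set Pot}
    {n : ℕ → ℝ → C.BgA → G.P → ℝ} {lip clip : ℕ → ℝ} {aP dP : G.P → ℝ} {δ : C.Dom → ℝ}
    {κ B lipbar clipbar pexbar qTbar τbar ω ℓ ν : ℝ} {wt : ℕ → ιc → ℝ} {τ : ℕ → ℕ → ℝ} {pex qT : ℕ → ℝ}
    (ρT : ℕ → (ιc → ℝ) → Pot) (expl : ℕ → ℝ → C.BgA → C.Dom → ℝ)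
    (h0 : ScaleZeroFree EA W) (hAdm : AdmissibleTerms EA W Adm) (hres : AdmRestrict Adm) (hadd : ChannelAdditive Adm T)
    (hsum : ChannelStepSum Adm T) (hstep : ChannelSizeAtStepNN Adm T κ wt τ) (hfac : Factorises EA W T Ψ)
    (hclip0 : ∀ k, 0 ≤ clip k)
    (hCup : ∀ g ∈ W, ∀ g' ∈ W, ∀ (k : ℕ) (U : C.BgA) (X : C.Dom), C.scale X = k + 1 → ∀ Q ∈ 𝒜 k, ∀ γ ∈ G.vol X,
      ‖act k (g k) U Q γ‖ ≤ n k (g' k) U γ ∧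
        ‖act k (g k) U Q γ - act k (g' k) U Q γ‖ ≤ clip k * |g k - g' k| * n k (g' k) U γ)
    (hqT0 : ∀ k, 0 ≤ qT k)
    (hTcup : ∀ g ∈ W, ∀ g' ∈ W, ∀ (k : ℕ) (y : ιc), |T k g (EA g) y - T k g' (EA g) y| ≤ wt k y * (qT k * |g k - g' k|))
    (hrepr : ∀ (k : ℕ) (s : ℝ) (P : ιc → ℝ) (U : C.BgA) (X : C.Dom),
      Ψ k s P U X = (G.newTerm act k s U X (ρT k P)).re + expl k s U X)
    (hexpl : ∀ g ∈ W, ∀ g' ∈ W, ∀ (k : ℕ) (U : C.BgA) (X : C.Dom), C.scale X = k + 1 →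
      |expl k (g k) U X - expl k (g' k) U X| ≤ Real.exp (-(κ * C.d X)) * (pex k * |g k - g' k|))
    (hclipb : ∀ k, clip k ≤ clipbar) (hpexb : ∀ k, pex k ≤ pexbar) (hpexbar : 0 ≤ pexbar) (hqTb : ∀ k, qT k ≤ qTbar)
    (hKP : TwoPointKP G W act 𝒜 n lip aP dP) (hdec : G.DecayExtract δ dP) (hpinB : G.PinBudget aP δ (fun _ => B) κ)
    (hρT : ∀ (k : ℕ) (P P' : ιc → ℝ) (M : ℝ), (∀ y, |P y - P' y| ≤ wt k y * M) → ‖ρT k P - ρT k P'‖ ≤ M)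
    (hocc : ∀ g ∈ W, ∀ g' ∈ W, ∀ k : ℕ, ρT k (T k g' (EA g)) ∈ 𝒜 k) (hB0 : 0 ≤ B)
    (hlipb : ∀ k, lip k ≤ lipbar) (hτbar : 0 ≤ τbar) (hω : 0 ≤ ω) (hpos : 0 < ω + 4 * lipbar * B * τbar)
    (hτ : ∀ k j, j ≤ k → 0 ≤ τ k j ∧ τ k j ≤ τbar * ω ^ (k - j))
    (hℓ : 4 * clipbar * B + pexbar + 4 * lipbar * B * qTbar = ℓ) (hν : ω + 4 * lipbar * B * τbar = ν)
    {A : (j : J) → (k : ℕ) → Matrix (ιt j k) (ιt j (k + 1)) ℂ} {Xt : (j : J) → (k : ℕ) → Matrix (ιt j k) (ιt j k) ℂ}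
    {r Cop θ₂ cR r₀ Λb Cm : ℝ} (towf : ℝ → ℕ → (ℕ → ℝ) → C.BgB → J) (opMidf : ℝ → (ℕ → ℝ) → C.BgB → ℕ → Op)
    (distf : ℝ → ℕ → (ℕ → ℝ) → C.BgB → ℝ) {ιR XR : Type*} (R₃ : Readings ιR XR)
    {EBfam : ℝ → Functional C C.BgB} {γ Λ₅ EA₀ E₀ Gi ρ₁ δ₁ δ₅ θ₁ θ₅ c₅ ω₅ ρ₀ B₅ C₅ : ℝ} {k₅ k₁ : ℕ}
    (hrt : 0 < r) (hAt : TowerContracting A r) (hlaw : TowerLaw A Xt r Cop θ₂)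
    (hreadf : ∀ b', 0 < b' → b' ≤ γ → ReadsTowerMid (Mf b') A Xt r W cR (towf b') (opMidf b'))
    (hcR : 0 ≤ cR) (hCop : 0 ≤ Cop) (hθ₂ : 0 ≤ θ₂) (hθ₂₁ : θ₂ ≤ θ₁)
    (hflf : ∀ b', 0 < b' → b' ≤ γ → ∀ k, r₀ ≤ (Mf b').rOp k) (hr₀ : 0 < r₀)
    (hLipf : ∀ b', 0 < b' → b' ≤ γ → ∀ k, ∀ g ∈ W, ∀ (U : C.BgB),
      ‖opMidf b' g U k - (Mf b').opB g U k‖ ≤ Λb * distf b' k g U * (Mf b').rOp k) (hΛb : 0 ≤ Λb)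
    (hR₃ : LocalRate R₃ Cm θ₁) (hCm : 0 ≤ Cm)
    (hdomf : ∀ b', 0 < b' → b' ≤ γ → ∀ k, ∀ g ∈ W, ∀ (U : C.BgB),
      ∃ V ∈ R₃.dom, ∃ x : XR, distf b' k g U ≤ |R₃.loc (k + 1) V x - R₃.loc k V x|)
    (hdA : DecayBound EA W EA₀ κ)
    (hrAf : ∀ b', 0 < b' → b' ≤ γ → (Mf b').RepresentsA EA W)
    (hrBf : ∀ b', 0 < b' → b' ≤ γ → (Mf b').RepresentsB (EBfam b') W)
    (hbasef : ∀ b', 0 < b' → b' ≤ γ → (Mf b').InBase (EBfam b') W)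
    (hlipf : ∀ b', 0 < b' → b' ≤ γ → (Mf b').DataLipschitz W κ Λ₅ ρ₀)
    (hdBf : ∀ b', 0 < b' → b' ≤ γ → DecayBound (EBfam b') W E₀ κ)
    (hreadIf : ∀ b', 0 < b' → b' ≤ γ → (InsOpModel.ofStep (Mf b') (Insf b')).ReadsIns W)
    (hienvf : ∀ b', 0 < b' → b' ≤ γ → (InsOpModel.ofStep (Mf b') (Insf b')).InsOpEnvelope W κ E₀ Gi)
    (hbdAf : ∀ b', 0 < b' → b' ≤ γ → (InsOpModel.ofStep (Mf b') (Insf b')).InsBoundA W κ E₀ Gi)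
    (hdampf : ∀ b', 0 < b' → b' ≤ γ → (Mf b').InsertionDampedNat W κ c₅ ω₅)
    (hδ₁ : cR * Cop / r₀ + Λb * Cm = δ₁) (hGi : 0 ≤ Gi) (hρ₁ : ρ₁ < 1) (hreach : δ₁ * θ₁ ^ k₁ ≤ ρ₁)
    (hδ₅ : Gi * δ₁ / (1 - ρ₁) + 2 * Gi / θ₁ ^ k₁ = δ₅)
    (hΛ₅ : 0 ≤ Λ₅) (hθ₁ : 0 < θ₁) (hθ₁₅ : θ₁ ≤ θ₅) (hθ₅1 : θ₅ ≤ 1) (hc₅ : 0 ≤ c₅) (hω₅ : 0 < ω₅)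
    (hnear : (δ₁ + δ₅) * θ₁ ^ k₅ + c₅ * (EA₀ + E₀) / (1 - ω₅) ≤ ρ₀) (hB₅ : 0 ≤ B₅)
    (hfirst : ∀ k < k₅, EA₀ + E₀ ≤ B₅ * θ₁ ^ k) (hsmall5 : ω₅ + Λ₅ * c₅ < θ₅)
    (hC₅ : (Λ₅ * (δ₁ + δ₅) + B₅) * (θ₅ - ω₅) / (θ₅ - (ω₅ + Λ₅ * c₅)) = C₅)
    {𝒜A : Set (Slice C C.BgA)} {𝒜B : Set (Slice C C.BgB)} {rA : ReadOut C C.BgA} {rB : ReadOut C C.BgB} {β : HBeta}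
    {cr : ℝ} (hW : ∀ k (v : Fin (k + 1) → ℝ), v ∈ Box γ k → extd v ∈ W)
    (hA : RepresentsA EA rA γ β) (hB : RepresentsB EBfam rB γ β)
    (h𝒜A : ∀ g' ∈ W, EA g' ∈ 𝒜A) (h𝒜B : ∀ b', 0 < b' → b' ≤ γ → ∀ g' ∈ W, EBfam b' g' ∈ 𝒜B)
    (hr : ReadBoundedOn 𝒜A rA κ cr) (hcov : ReadCovariantOn 𝒜A 𝒜B rA rB κ cr) (hcr : 0 ≤ cr)
    -- ===== node U1/H3's runs, the rates and the window =====
    {ρ : ℝ} (g : ℕ → ℕ → ℝ) (gIR : ℝ) (hθ₅ρ : θ₅ ≤ ρ) (hνρ : ν < ρ) (hρ0 : 0 < ρ) (hρ1 : ρ < 1) (hγ : 0 ≤ γ)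
    (hrun : ∀ K, RGEqH K β (g K)) (hbox : ∀ K i, i ≤ K → 0 < g K i ∧ g K i ≤ γ) (hpin : ∀ K, g K K = gIR)
    (hsmall : cr * (ℓ / ν) * ν * (γ ^ 3 / 2) * (ρ / (ρ - ν)) ≤ (1 - ρ) / 2) :
    InjectedRate (2 * (cr * C₅ * θ₅) / (1 - ρ)) 0 ρ (fun K j => disc (g K) (g (K + 1)) j) := by
  subst hℓ hν hδ₁ hδ₅ hC₅
  have hK := ne9_and_fadingMemory_of_couplingTwoPoint G ρT expl h0 hAdm hres hadd hsum hstep hfac hclip0 hCup hqT0 hTcup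
    hrepr hexpl hclipb hpexb hpexbar hqTb hKP hdec hpinB hρT hocc hB0 hlipb hτbar hω hpos hτ
  obtain ⟨hS, hL, hM⟩ := ne4_of_endNE9_towerSplitIns G Mf Insf ρT expl h0 hAdm hres hadd hsum hstep hfac hclip0 hCup hqT0
    hTcup hrepr hexpl hclipb hpexb hpexbar hqTb hKP hdec hpinB hρT hocc hB0 hlipb hτbar hω hpos hτ rfl rfl towf opMidf
    distf R₃ hrt hAt hlaw hreadf hcR hCop hθ₂ hθ₂₁ hflf hr₀ hLipf hΛb hR₃ hCm hdomf hdA hrAf hrBf hbasef hlipf hdBf hreadIf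
    hienvf hbdAf hdampf rfl hGi hρ₁ hreach rfl hΛ₅ hθ₁ hθ₁₅ hθ₅1 hc₅ hω₅ hnear hB₅ hfirst hsmall5 rfl hW hA hB h𝒜A h𝒜B
    hr hcov hcr
  obtain ⟨-, hd⟩ := splitInsConst_nonneg (k₁ := k₁) hcR hCop hr₀ hΛb hCm hGi hρ₁ hθ₁
  exact T4CurrencyMatching.injectedRate_of_runs_gap g gIR hρ0 hρ1 (hθ₁.le.trans hθ₁₅) hθ₅ρ hpos.le hνρ
    (mul_nonneg (mul_nonneg hcr (faceConst_nonneg hΛ₅ hd hc₅ hB₅ hsmall5)) (hθ₁.le.trans hθ₁₅))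
    (mul_nonneg (mul_nonneg hcr (T4BetaReadOut.fadingMemory_const_nonneg hK.2)) hpos.le) hγ hrun hbox hpin hS hL hM hsmall
/-! ## §3 The spine's `K`-uniform term-wise matching with node U2 fed by NE9's END and the tower-split face -/

/-- **ROW NE4 IN THE SPINE — `URateUpTo K`, `K`-UNIFORM, ROW NE5's RATE INPUTS READ FROM ROWS NE2 ∧ NE3, W4 PRODUCED.**
`T4TowerRateDischarge.uRateUpTo_of_nodes` with `h9`/`hΛ` := row NE9's END theorem, `h5` := the same composition for the TOWER
PAIR (`EA`, `EB`) through ONE `M` read by `Ins`/`tow`/`opMid`/`dist`, `hinj` := §2, node U1b `hU`/`hG`/`hP`, nodes U5/U6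
`hloc` (the spine's OWN carrier `R` ≠ `R₃`) / `hgd`, the runs in `W`, target rate `θ′ > max ν ρ`. [folklore] -/
theorem uRateUpTo_of_endNE9_towerSplitIns (G : ClusterGeom C) {Pot : Type*} [NormedAddCommGroup Pot]
    [NormedSpace ℂ Pot] {Op Hist : Type*} [NormedAddCommGroup Op] [NormedSpace ℂ Op] [NormedAddCommGroup Hist]
    [NormedSpace ℂ Hist] [CompleteSpace Hist] {J : Type*} {ιt : J → ℕ → Type*} [∀ j k, Fintype (ιt j k)] [∀ j k, DecidableEq (ιt j k)]
    (M : StepModel C Op Hist) (Ins : ℕ → Op → (C.Dom → ℝ) → Hist) (Mf : ℝ → StepModel C Op Hist)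
    (Insf : ℝ → ℕ → Op → (C.Dom → ℝ) → Hist) {ιc : Type} {EA : Functional C C.BgA} {W : Set (ℕ → ℝ)}
    {Adm : Set (C.BgA → C.Dom → ℝ)} {T : ℕ → (ℕ → ℝ) → (C.BgA → C.Dom → ℝ) → ιc → ℝ}
    {Ψ : ℕ → ℝ → (ιc → ℝ) → C.BgA → C.Dom → ℝ} {act : ℕ → ℝ → C.BgA → Pot → G.P → ℂ} {𝒜 : ℕ → Set Pot}
    {n : ℕ → ℝ → C.BgA → G.P → ℝ} {lip clip : ℕ → ℝ} {aP dP : G.P → ℝ} {δ : C.Dom → ℝ}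
    {κ B lipbar clipbar pexbar qTbar τbar ω ℓ ν : ℝ} {wt : ℕ → ιc → ℝ} {τ : ℕ → ℕ → ℝ} {pex qT : ℕ → ℝ}
    (ρT : ℕ → (ιc → ℝ) → Pot) (expl : ℕ → ℝ → C.BgA → C.Dom → ℝ)
    -- ===== row NE9's END theorem =====
    (h0 : ScaleZeroFree EA W) (hAdm : AdmissibleTerms EA W Adm) (hres : AdmRestrict Adm) (hadd : ChannelAdditive Adm T)
    (hsum : ChannelStepSum Adm T) (hstep : ChannelSizeAtStepNN Adm T κ wt τ) (hfac : Factorises EA W T Ψ)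
    (hclip0 : ∀ k, 0 ≤ clip k)
    (hCup : ∀ g ∈ W, ∀ g' ∈ W, ∀ (k : ℕ) (U : C.BgA) (X : C.Dom), C.scale X = k + 1 → ∀ Q ∈ 𝒜 k, ∀ γ ∈ G.vol X,
      ‖act k (g k) U Q γ‖ ≤ n k (g' k) U γ ∧
        ‖act k (g k) U Q γ - act k (g' k) U Q γ‖ ≤ clip k * |g k - g' k| * n k (g' k) U γ)
    (hqT0 : ∀ k, 0 ≤ qT k)
    (hTcup : ∀ g ∈ W, ∀ g' ∈ W, ∀ (k : ℕ) (y : ιc), |T k g (EA g) y - T k g' (EA g) y| ≤ wt k y * (qT k * |g k - g' k|))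
    (hrepr : ∀ (k : ℕ) (s : ℝ) (P : ιc → ℝ) (U : C.BgA) (X : C.Dom),
      Ψ k s P U X = (G.newTerm act k s U X (ρT k P)).re + expl k s U X)
    (hexpl : ∀ g ∈ W, ∀ g' ∈ W, ∀ (k : ℕ) (U : C.BgA) (X : C.Dom), C.scale X = k + 1 →
      |expl k (g k) U X - expl k (g' k) U X| ≤ Real.exp (-(κ * C.d X)) * (pex k * |g k - g' k|))
    (hclipb : ∀ k, clip k ≤ clipbar) (hpexb : ∀ k, pex k ≤ pexbar) (hpexbar : 0 ≤ pexbar) (hqTb : ∀ k, qT k ≤ qTbar)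
    (hKP : TwoPointKP G W act 𝒜 n lip aP dP) (hdec : G.DecayExtract δ dP) (hpinB : G.PinBudget aP δ (fun _ => B) κ)
    (hρT : ∀ (k : ℕ) (P P' : ιc → ℝ) (M : ℝ), (∀ y, |P y - P' y| ≤ wt k y * M) → ‖ρT k P - ρT k P'‖ ≤ M)
    (hocc : ∀ g ∈ W, ∀ g' ∈ W, ∀ k : ℕ, ρT k (T k g' (EA g)) ∈ 𝒜 k) (hB0 : 0 ≤ B)
    (hlipb : ∀ k, lip k ≤ lipbar) (hτbar : 0 ≤ τbar) (hω : 0 ≤ ω) (hpos : 0 < ω + 4 * lipbar * B * τbar)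
    (hτ : ∀ k j, j ≤ k → 0 ≤ τ k j ∧ τ k j ≤ τbar * ω ^ (k - j))
    (hℓ : 4 * clipbar * B + pexbar + 4 * lipbar * B * qTbar = ℓ) (hν : ω + 4 * lipbar * B * τbar = ν)
    -- ===== row NE5's END, tower-split face: tower pair through `M`, read-out family through `Mf b′` =====
    {A : (j : J) → (k : ℕ) → Matrix (ιt j k) (ιt j (k + 1)) ℂ} {Xt : (j : J) → (k : ℕ) → Matrix (ιt j k) (ιt j k) ℂ}
    {r Cop θ₂ cR r₀ Λb Cm : ℝ} (tow : ℕ → (ℕ → ℝ) → C.BgB → J) (opMid : (ℕ → ℝ) → C.BgB → ℕ → Op)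
    (dist : ℕ → (ℕ → ℝ) → C.BgB → ℝ) (towf : ℝ → ℕ → (ℕ → ℝ) → C.BgB → J)
    (opMidf : ℝ → (ℕ → ℝ) → C.BgB → ℕ → Op) (distf : ℝ → ℕ → (ℕ → ℝ) → C.BgB → ℝ) {ιR XR : Type*}
    (R₃ : Readings ιR XR) {EB : Functional C C.BgB} {EBfam : ℝ → Functional C C.BgB}
    {γ Λ₅ EA₀ E₀ Gi ρ₁ δ₁ δ₅ θ₁ θ₅ c₅ ω₅ ρ₀ B₅ C₅ : ℝ} {k₅ k₁ : ℕ}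
    (hrt : 0 < r) (hAt : TowerContracting A r) (hlaw : TowerLaw A Xt r Cop θ₂)
    (hread : ReadsTowerMid M A Xt r W cR tow opMid)
    (hreadf : ∀ b', 0 < b' → b' ≤ γ → ReadsTowerMid (Mf b') A Xt r W cR (towf b') (opMidf b'))
    (hcR : 0 ≤ cR) (hCop : 0 ≤ Cop) (hθ₂ : 0 ≤ θ₂) (hθ₂₁ : θ₂ ≤ θ₁) (hfl : ∀ k, r₀ ≤ M.rOp k)
    (hflf : ∀ b', 0 < b' → b' ≤ γ → ∀ k, r₀ ≤ (Mf b').rOp k) (hr₀ : 0 < r₀)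
    (hLip : ∀ k, ∀ g ∈ W, ∀ (U : C.BgB), ‖opMid g U k - M.opB g U k‖ ≤ Λb * dist k g U * M.rOp k)
    (hLipf : ∀ b', 0 < b' → b' ≤ γ → ∀ k, ∀ g ∈ W, ∀ (U : C.BgB),
      ‖opMidf b' g U k - (Mf b').opB g U k‖ ≤ Λb * distf b' k g U * (Mf b').rOp k) (hΛb : 0 ≤ Λb)
    (hR₃ : LocalRate R₃ Cm θ₁) (hCm : 0 ≤ Cm)
    (hdom : ∀ k, ∀ g ∈ W, ∀ (U : C.BgB), ∃ V ∈ R₃.dom, ∃ x : XR, dist k g U ≤ |R₃.loc (k + 1) V x - R₃.loc k V x|)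
    (hdomf : ∀ b', 0 < b' → b' ≤ γ → ∀ k, ∀ g ∈ W, ∀ (U : C.BgB),
      ∃ V ∈ R₃.dom, ∃ x : XR, distf b' k g U ≤ |R₃.loc (k + 1) V x - R₃.loc k V x|)
    (hrA : M.RepresentsA EA W) (hrB : M.RepresentsB EB W) (hbase : M.InBase EB W) (hlip5 : M.DataLipschitz W κ Λ₅ ρ₀)
    (hdA : DecayBound EA W EA₀ κ) (hdB : DecayBound EB W E₀ κ) (hreadI : (InsOpModel.ofStep M Ins).ReadsIns W)
    (hienv : (InsOpModel.ofStep M Ins).InsOpEnvelope W κ E₀ Gi) (hbdA : (InsOpModel.ofStep M Ins).InsBoundA W κ E₀ Gi)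
    (hdamp : M.InsertionDampedNat W κ c₅ ω₅)
    (hrAf : ∀ b', 0 < b' → b' ≤ γ → (Mf b').RepresentsA EA W)
    (hrBf : ∀ b', 0 < b' → b' ≤ γ → (Mf b').RepresentsB (EBfam b') W)
    (hbasef : ∀ b', 0 < b' → b' ≤ γ → (Mf b').InBase (EBfam b') W)
    (hlipf : ∀ b', 0 < b' → b' ≤ γ → (Mf b').DataLipschitz W κ Λ₅ ρ₀)
    (hdBf : ∀ b', 0 < b' → b' ≤ γ → DecayBound (EBfam b') W E₀ κ)
    (hreadIf : ∀ b', 0 < b' → b' ≤ γ → (InsOpModel.ofStep (Mf b') (Insf b')).ReadsIns W)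
    (hienvf : ∀ b', 0 < b' → b' ≤ γ → (InsOpModel.ofStep (Mf b') (Insf b')).InsOpEnvelope W κ E₀ Gi)
    (hbdAf : ∀ b', 0 < b' → b' ≤ γ → (InsOpModel.ofStep (Mf b') (Insf b')).InsBoundA W κ E₀ Gi)
    (hdampf : ∀ b', 0 < b' → b' ≤ γ → (Mf b').InsertionDampedNat W κ c₅ ω₅)
    (hδ₁ : cR * Cop / r₀ + Λb * Cm = δ₁) (hGi : 0 ≤ Gi) (hρ₁ : ρ₁ < 1) (hreach : δ₁ * θ₁ ^ k₁ ≤ ρ₁)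
    (hδ₅ : Gi * δ₁ / (1 - ρ₁) + 2 * Gi / θ₁ ^ k₁ = δ₅)
    (hΛ₅ : 0 ≤ Λ₅) (hθ₁ : 0 < θ₁) (hθ₁₅ : θ₁ ≤ θ₅) (hθ₅1 : θ₅ ≤ 1) (hc₅ : 0 ≤ c₅) (hω₅ : 0 < ω₅)
    (hnear : (δ₁ + δ₅) * θ₁ ^ k₅ + c₅ * (EA₀ + E₀) / (1 - ω₅) ≤ ρ₀) (hB₅ : 0 ≤ B₅)
    (hfirst : ∀ k < k₅, EA₀ + E₀ ≤ B₅ * θ₁ ^ k) (hsmall5 : ω₅ + Λ₅ * c₅ < θ₅)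
    (hC₅ : (Λ₅ * (δ₁ + δ₅) + B₅) * (θ₅ - ω₅) / (θ₅ - (ω₅ + Λ₅ * c₅)) = C₅)
    -- ===== node U2's read-out (R) =====
    {𝒜A : Set (Slice C C.BgA)} {𝒜B : Set (Slice C C.BgB)} {rA : ReadOut C C.BgA} {rB : ReadOut C C.BgB} {β : HBeta}
    {cr : ℝ} (hW : ∀ k (v : Fin (k + 1) → ℝ), v ∈ Box γ k → extd v ∈ W)
    (hA : RepresentsA EA rA γ β) (hB : RepresentsB EBfam rB γ β)
    (h𝒜A : ∀ g' ∈ W, EA g' ∈ 𝒜A) (h𝒜B : ∀ b', 0 < b' → b' ≤ γ → ∀ g' ∈ W, EBfam b' g' ∈ 𝒜B)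
    (hr : ReadBoundedOn 𝒜A rA κ cr) (hcov : ReadCovariantOn 𝒜A 𝒜B rA rB κ cr) (hcr : 0 ≤ cr)
    -- ===== node U1/H3's runs, the rates and the window =====
    {ρ : ℝ} {g : ℕ → ℕ → ℝ} (gIR : ℝ) (hθ₅ρ : θ₅ ≤ ρ) (hνρ : ν < ρ) (hρ0 : 0 < ρ) (hρ1 : ρ < 1) (hγ : 0 ≤ γ)
    (hrun : ∀ K, RGEqH K β (g K)) (hbox : ∀ K i, i ≤ K → 0 < g K i ∧ g K i ≤ γ) (hpin : ∀ K, g K K = gIR)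
    (hsmall : cr * (ℓ / ν) * ν * (γ ^ 3 / 2) * (ρ / (ρ - ν)) ≤ (1 - ρ) / 2)
    (hgA : ∀ K, g K ∈ W) (hgB : ∀ K, (fun i => g (K + 1) (i + 1)) ∈ W)
    -- ===== node U1b, nodes U5/U6, the target rate =====
    {R : Readings ι X} {C₃ θ₃ P θ' : ℝ} {q : ℕ} {CU : (ℕ → ℝ) → ℕ → ℝ} {uA : ℕ → ι → C.BgA} {uB : ℕ → ι → C.BgB}
    (hU : LipBackground EA W κ CU) (hG : PolyLipGrowth CU g P q) (hP : 0 ≤ P)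
    (hloc : LocalRate R C₃ θ₃) (hC₃ : 0 ≤ C₃) (hθ₃ : 0 ≤ θ₃) (hθ₃1 : θ₃ < 1) (hgd : GaugeDominated R uA uB)
    (hθ' : max ν ρ < θ') (hθ₅' : θ₅ ≤ θ') (hθ₃' : θ₃ ≤ θ') :
    ∃ a : ℝ, 0 ≤ a ∧ ∀ K, URateUpTo K EA EB (g K) (fun i => g (K + 1) (i + 1)) (uA K) (uB K) R.dom
      (a + ℓ / ν * (γ ^ 3 * (2 * (cr * C₅ * θ₅) / (1 - ρ))) * (θ' / (θ' - max ν ρ)) + C₅) θ' κ := by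
  subst hℓ hν hδ₁ hδ₅ hC₅
  have hK := ne9_and_fadingMemory_of_couplingTwoPoint G ρT expl h0 hAdm hres hadd hsum hstep hfac hclip0 hCup hqT0 hTcup
    hrepr hexpl hclipb hpexb hpexbar hqTb hKP hdec hpinB hρT hocc hB0 hlipb hτbar hω hpos hτ
  obtain ⟨hd₁, hd⟩ := splitInsConst_nonneg (k₁ := k₁) hcR hCop hr₀ hΛb hCm hGi hρ₁ hθ₁
  have hC₅nn := faceConst_nonneg hΛ₅ hd hc₅ hB₅ hsmall5
  have hθ₁1 : θ₁ ≤ 1 := hθ₁₅.trans hθ₅1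
  have hop := operatorRate_of_towerLaw_split M opMid dist R₃ hrt hAt hlaw hread hcR hCop hθ₂ hθ₂₁ hfl hr₀ hLip hΛb hR₃
    hdom
  have h5 := M.ne5_at_of_stepModel_lip_nat hrA hrB hbase hlip5 hdA hdB hop
    (insertionRate_of_operatorRate M Ins hreadI hienv hbdA hop hd₁ hθ₁ hθ₁1 hρ₁ hreach) hdamp hΛ₅ hd hθ₁.le hθ₁₅ hθ₅1
    hc₅ hω₅ hnear hB₅ hfirst hsmall5
  have hinj := injectedRate_of_endNE9_towerSplitIns G Mf Insf ρT expl h0 hAdm hres hadd hsum hstep hfac hclip0 hCup hqT0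
    hTcup hrepr hexpl hclipb hpexb hpexbar hqTb hKP hdec hpinB hρT hocc hB0 hlipb hτbar hω hpos hτ rfl rfl towf opMidf
    distf R₃ hrt hAt hlaw hreadf hcR hCop hθ₂ hθ₂₁ hflf hr₀ hLipf hΛb hR₃ hCm hdomf hdA hrAf hrBf hbasef hlipf hdBf hreadIf
    hienvf hbdAf hdampf rfl hGi hρ₁ hreach rfl hΛ₅ hθ₁ hθ₁₅ hθ₅1 hc₅ hω₅ hnear hB₅ hfirst hsmall5 rfl hW hA hB h𝒜A h𝒜B
    hr hcov hcr g gIR hθ₅ρ hνρ hρ0 hρ1 hγ hrun hbox hpin hsmall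
  exact uRateUpTo_of_nodes hK.1 hK.2 hpos.le hU hG hP h5 (hθ₁.le.trans hθ₁₅) hC₅nn hloc hC₃ hθ₃ hθ₃1 hgd hinj
    (div_nonneg (mul_nonneg zero_le_two (mul_nonneg (mul_nonneg hcr hC₅nn) (hθ₁.le.trans hθ₁₅))) (by linarith)) hρ0.le
    hbox hgA hgB hθ' hθ₅' hθ₃'

end Summit.QuantumFields.BalabanUV.T4Continuum.NE4ReadOutSocketTower
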